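import Summits.ResolutionOfSingularities.ResolutionOfSingularities.Theorems.FrobeniusLadderFInjectiveMacaulayficationFanCheckMulti
import Summits.ResolutionOfSingularities.ResolutionOfSingularities.Theorems.FrobeniusLadderFInjectiveMacaulayficationFanCheckProduct
import HarnessLib

/-!
# Fan-check kit, CHUNKED kernel checks: `checkHge` ray-chunk by ray-chunk, and the sparse cover records block by block of the product table
# (crux `FInjectiveMacaulayfication` stmt-ResolutionOfSingularities-15315, chain w45a; (W-TD) BED D storey 1 (D-1), res-L1-w45a-plan-1 R21.18 (4); seat res-L1-w45a-stub-2 g10)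

[OURS · L1 W4.5a] Support file (`--supports stmt-ResolutionOfSingularities-15315 --as helper`); generic glue for the road-B data kit
`FanCheckKit` / `FanCheckSound` (res-L1-w45a-stub-4), `FanCheckMulti`, `FanCheckProduct`; NOT a statement of any manuscript; AI-written (AI review is weaker than expert review).

WHY. At BED D storey 1 (327 charts, 55 rays, 9835 generators) the two bulk checks `checkHge` (one pass over the rays, ≈ 5·10⁵ dot products) and the cover
records (≈ 10⁴ records) each exceed the kernel's default heartbeat budget as ONE `decide`; this file splits them soundly:
* `checkHgeFrom_append` — `checkHgeFrom j (l₁ ++ l₂) = checkHgeFrom j l₁ && checkHgeFrom (j + |l₁|) l₂`, so `checkHge AL2 (R₀ ++ … ++ R₄) CL` follows from five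
  ray-chunk checks;
* `blockGens KL2 j` — the `j`-th block `[b + e_j : b ∈ K]` of the product table `prodGens n KL2` (`mem_blockGens_of_mem_prodGens`); `checkHcovMultiL` — the sparse
  multi-vertex record check of `FanCheckMulti` against an EXPLICIT generator list; `hcov_of_checkMultiL` (soundness per list) and ★ `hcov_of_blocks` — the `hcov` binder of
  `CICertificates.ciCertificates` at `A := genSet n (prodGens n KL2)` from one block check per `j < n`.
Definitions are computable list programs (no instances, no notation); no named facts. [folklore]
-/

-- single-problem summit: the doubled namespace component is forced
set_option linter.dupNamespace false

namespace Summit.ResolutionOfSingularities.ResolutionOfSingularities.Theorems.FInjectiveMacaulayfication.FanCheckChunks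

open Summit.ResolutionOfSingularities.ResolutionOfSingularities.Theorems.FInjectiveMacaulayfication
open FanCheckKit FanCheckSound FanCheckMulti FanCheckProduct MvPolynomial

/-! ## §1 `checkHge` by ray chunks -/

/-- `checkHgeFrom` splits over an append of the ray list (the running index shifts by the length of the first part). [folklore] -/
theorem checkHgeFrom_append (AL2 : List (List (List ℕ))) (CL : List (List ℕ × (ℕ × ℕ) × List (ℕ × ℕ) × List (List ℕ))) :
    ∀ (j : ℕ) (l₁ l₂ : List (List ℕ)), checkHgeFrom AL2 CL j (l₁ ++ l₂) = (checkHgeFrom AL2 CL j l₁ && checkHgeFrom AL2 CL (j + l₁.length) l₂)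
  | j, [], l₂ => by rw [List.nil_append, checkHgeFrom, Bool.true_and, List.length_nil, Nat.add_zero]
  | j, v :: vs, l₂ => by
    rw [List.cons_append, checkHgeFrom, checkHgeFrom, checkHgeFrom_append AL2 CL (j + 1) vs l₂, Bool.and_assoc, List.length_cons,
      Nat.add_assoc, Nat.add_comm 1]

/-- Two ray chunks. [folklore] -/
theorem checkHgeFrom_append_true {AL2 : List (List (List ℕ))} {CL : List (List ℕ × (ℕ × ℕ) × List (ℕ × ℕ) × List (List ℕ))} {j : ℕ}
    {l₁ l₂ : List (List ℕ)} (h₁ : checkHgeFrom AL2 CL j l₁ = true) (h₂ : checkHgeFrom AL2 CL (j + l₁.length) l₂ = true) :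
    checkHgeFrom AL2 CL j (l₁ ++ l₂) = true := by
  rw [checkHgeFrom_append, h₁, h₂, Bool.and_self]

/-! ## §2 The cover records block by block -/

/-- The `j`-th block of the product table: `[b + e_j : b ∈ K]` (flat). [folklore] -/
def blockGens (KL2 : List (List (List ℕ))) (j : ℕ) : List (List ℕ) := (KL2.map fun ch => ch.map fun b => addUnitL b j).flatten

/-- Every generator of the product table lies in some block. [folklore] -/
theorem mem_blockGens_of_mem_prodGens {n : ℕ} {KL2 : List (List (List ℕ))} {v : List ℕ} (hv : v ∈ (prodGens n KL2).flatten) :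
    ∃ j < n, v ∈ blockGens KL2 j := by
  obtain ⟨j, hj, b, hb, rfl⟩ := mem_flatten_prodGens.mp hv
  refine ⟨j, hj, ?_⟩
  obtain ⟨ch, hch, hbch⟩ := List.mem_flatten.mp hb
  exact List.mem_flatten.mpr ⟨_, List.mem_map.mpr ⟨ch, hch, rfl⟩, List.mem_map.mpr ⟨b, hbch, rfl⟩⟩

/-- (hcov, sparse multi-vertex records, against an explicit generator list `L`) — `FanCheckMulti.checkHcovMulti` with `AL2.flatten` replaced by `L`. [folklore] -/
def checkHcovMultiL (n : ℕ) (L : List (List ℕ)) (MV2 : List (List (List ℕ))) (w t : ℕ) (RLM : List (List (ℕ × ℕ) × List ℕ)) : Bool :=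
  Nat.beq L.length RLM.length && (L.zip RLM).all fun ar =>
    (match ar.2.1 with
      | [] => false
      | e :: _ => Nat.ble 1 e.2) &&
    (ar.2.1.all fun e => Nat.blt e.1 t) && Nat.beq ar.2.2.length n &&
      veqL (smulL (sumCnt ar.2.1) ar.1) (addL (sumVerts n MV2 w ar.2.1) ar.2.2)

/-- Soundness of the block check: the `hcov` witness for every vector of the explicit list `L` (generator set `A := genSet n AL2` of the ambient table). [folklore] -/
theorem hcov_of_checkMultiL (k : Type) [CommSemiring k] {n r : ℕ} (AL2 MV2 : List (List (List ℕ))) (RAYS : List (List ℕ))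
    (CL : List (List ℕ × (ℕ × ℕ) × List (ℕ × ℕ) × List (List ℕ))) (w t : ℕ) (L : List (List ℕ)) (RLM : List (List (ℕ × ℕ) × List ℕ))
    (hsh : checkShapes n r AL2 RAYS CL = true) (ht : CL.length = t) (hb : checkMVBridge n AL2 MV2 w t CL = true)
    (h : checkHcovMultiL n L MV2 w t RLM = true) :
    ∀ al ∈ L, ∃ (c : Fin t) (K : ℕ), 1 ≤ K ∧
      ∃ y ∈ (Ideal.span ((fun b : Fin n →₀ ℕ => (monomial b (1 : k) : MvPolynomial (Fin n) k)) ''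
          (genSet n AL2 : Set (Fin n →₀ ℕ)))) ^ (K - 1),
        (monomial (expOf n al) (1 : k) : MvPolynomial (Fin n) k) ^ K = monomial (chartM n AL2 CL t c) 1 * y := by
  intro al hal
  obtain ⟨p, hp, hpal⟩ := exists_getL_eq_of_mem L [] hal
  simp only [checkHcovMultiL, Bool.and_eq_true, Nat.beq_eq, List.all_eq_true] at h
  obtain ⟨hlenRL, hall⟩ := h
  have hmem := mk_getL_mem_zip L RLM [] ([], []) p hp (by rw [← hlenRL]; exact hp)
  rw [hpal] at hmem
  have hrec := hall _ hmem
  rcases hrc : getL RLM p ([], []) with ⟨_ | ⟨⟨c₀, cnt₀⟩, L'⟩, r'⟩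
  · rw [hrc] at hrec
    simp at hrec
  · rw [hrc] at hrec
    simp only [Nat.ble_eq, Nat.blt_eq] at hrec
    obtain ⟨⟨⟨hhead, hlt⟩, hrlen⟩, hveq⟩ := hrec
    exact hcov_of_record k AL2 MV2 RAYS CL w t hsh ht hb al c₀ cnt₀ L' r' hhead hlt hrlen (eq_of_veqL _ _ hveq)

/-- ★ **(hcov) FROM BLOCK CHECKS**: for the product table `AL2 = prodGens n KL2`, one sparse-record check per block `j < n` gives the `hcov` binder of
`CICertificates.ciCertificates` for every generator. [folklore] -/
theorem hcov_of_blocks (k : Type) [CommSemiring k] {n r : ℕ} (KL2 MV2 : List (List (List ℕ))) (RAYS : List (List ℕ))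
    (CL : List (List ℕ × (ℕ × ℕ) × List (ℕ × ℕ) × List (List ℕ))) (w t : ℕ) (RLMB : ℕ → List (List (ℕ × ℕ) × List ℕ))
    (hsh : checkShapes n r (prodGens n KL2) RAYS CL = true) (ht : CL.length = t) (hb : checkMVBridge n (prodGens n KL2) MV2 w t CL = true)
    (hall : ∀ j < n, checkHcovMultiL n (blockGens KL2 j) MV2 w t (RLMB j) = true) :
    ∀ a ∈ genSet n (prodGens n KL2), ∃ (c : Fin t) (K : ℕ), 1 ≤ K ∧
      ∃ y ∈ (Ideal.span ((fun b : Fin n →₀ ℕ => (monomial b (1 : k) : MvPolynomial (Fin n) k)) ''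
          (genSet n (prodGens n KL2) : Set (Fin n →₀ ℕ)))) ^ (K - 1),
        (monomial a (1 : k) : MvPolynomial (Fin n) k) ^ K = monomial (chartM n (prodGens n KL2) CL t c) 1 * y := by
  intro a ha
  obtain ⟨al, hal, rfl⟩ := exists_of_mem_genSet ha
  obtain ⟨j, hj, hblk⟩ := mem_blockGens_of_mem_prodGens hal
  exact hcov_of_checkMultiL k (prodGens n KL2) MV2 RAYS CL w t (blockGens KL2 j) (RLMB j) hsh ht hb (hall j hj) al hblk

end Summit.ResolutionOfSingularities.ResolutionOfSingularities.Theorems.FInjectiveMacaulayfication.FanCheckChunks
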